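import Literature.Probability.LatticeModels.PlanarIsingOnePointProofs
import Literature.Probability.LatticeModels.PlusDomainCorrComparison
import Literature.Probability.LatticeModels.IsingTranslationInvariance
import Literature.Probability.LatticeModels.DirInvCorrLength
import HarnessLib

/-!
# CHI Theorem 1.1 from the convergence of ratios (Prop. 2.20) and of free/plus ratios (Thm. 1.7)

Companion to `PlanarIsingOnePointProofs.lean`, towards the named fact
`Literature.Probability.LatticeModels.chi_onePoint_rho` (Chelkak–Hongler–Izyurov, *Conformal
invariance of spin correlations in the planar Ising model*, Ann. of Math. 181 (2015) 1087–1138 =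
arXiv:1202.2838 (CHI); numbering of the arXiv version). That file reduced CHI Thm 1.3 (`k = 0`) to
CHI Thm 1.1 in both boundary conditions (`chi_onePoint_rho_of_twoPoint`). This file formalises the
next layer down of the printed proof, **§2.9 "From ratios of correlations to Theorem 1.1"**
(pp. 17–19), sorry-free and without new named facts: CHI Thm 1.1 (`+` and free boundary conditions,
`ϱ(δ)`-normalised, pointwise) follows from

* `hR` — **CHI Prop. 2.20 with Remark 2.21, `k = 1`** (convergence of *ratios* of two-point
  functions inside one domain to the ratios of the explicit limits (1.2)–(1.3)), in the form with one
  marked point moving with the mesh, `y(δ) → y₀` (CHI's statements are uniform over marked faces at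
  distance `≥ ε` from the boundary and from each other, which contains this form):
  `𝔼⁺_{Ω_δ}[σ_xσ_{y(δ)}] / 𝔼⁺_{Ω_δ}[σ_xσ_{y'}] → ⟨σ_xσ_{y₀}⟩⁺_Ω / ⟨σ_xσ_{y'}⟩⁺_Ω`;
* `hB` — **CHI Thm. 1.7** (Kramers–Wannier companion: the ratio free/plus converges to the conformal
  invariant `𝓑_Ω = ⟨σσ⟩^free_Ω/⟨σσ⟩⁺_Ω`, `bCHI`), same moving-point form:
  `𝔼^free_{Ω_δ}[σ_xσ_{y(δ)}] / 𝔼⁺_{Ω_δ}[σ_xσ_{y(δ)}] → 𝓑_Ω(x; y₀)`,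

each for the domain `Ω` at hand AND for the unit disc `𝔻` (uniformised by the inverse Cayley map).
Main results: `tendsto_twoPoint_rho_of_ratios` (one domain, one pair of points),
`chi_twoPoint_rho_of_ratios` (CHI Thm 1.1, both boundary conditions, for all admissible approximable
domains) and `chi_onePoint_rho_of_ratios` (the named fact `chi_onePoint_rho` from `hR`, `hB`).
The two hypotheses are the outputs of the discrete-spinor-observable analysis (CHI Thms 1.5, 1.7,
§§2.2–2.8, §3), which the tree does not have yet; they are hypotheses (binders), not named facts.

## The printed argument and its rendering here (CHI pp. 18–19)

CHI write, for `a, b ∈ Ω` and an auxiliary scale `ε`,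
`𝔼⁺_Ω[σ_aσ_b]/ϱ(δ) = (𝔼⁺_Ω[σ_aσ_b]/𝔼⁺_Ω[σ_aσ_{a+ε}]) · (𝔼⁺_Ω[σ_aσ_{a+ε}]/𝔼_{ℂ_δ}[σ_aσ_{a+ε}]) ·
(𝔼_{ℂ_δ}[σ_aσ_{a+ε}]/𝔼_{ℂ_δ}[σ_aσ_{a+1}])`, control the middle factor by Lemma 2.24 (FKG sandwich
`𝔼^free_Λ ≤ 𝔼_ℂ ≤ 𝔼⁺_Ω` plus Thm 1.7 and `𝓑 → 1` as the points merge), the last factor by the same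
lemma in "a large domain `Λ_δ` containing `a, a+ε, a+1`" plus Prop 2.20 there, and conclude with the
explicit continuum limit (2.23)/(bulk limit). Here:

* `𝔼_{ℂ_δ}` is the plus state `twoPointPlus 2 β_c` of `ℤ²` (`ϱ(δ) = rhoCHI δ` is one of its values),
  and the FKG/GKS sandwich is `meshIsingFreeCorr ≤ twoPointPlus ≤ meshIsingPlusCorr`
  (`meshIsingFreeCorr_two_le_twoPointPlus`, `twoPointPlus_le_meshIsingPlusCorr_two`: GKS volume
  monotonicity `isingCorr_plus_le_of_subset_right`, `isingCorr_free_le_of_subset`, the box limits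
  `plusCorr_le_isingCorr_plus_box`, `isingCorr_free_box_le_freeCorr`, `freeCorr_le_plusCorr`,
  translation invariance `plusCorr_shift`, and the transfer `isingExpect_discreteDomainGraph_eq` from
  the graph `Ω_δ` to `ℤ²`, exact because free sites are joined to all four neighbours).
* The "large domain `Λ`" is realised WITHOUT leaving the tree's stock of approximable domains: since
  `ϱ(δ) = ⟨σ_0σ_{[p₁/δ]}⟩_{ℤ²}` with `p₁ = e^{iπ/4}` and `[(p₁/R)/(δ/R)] = [p₁/δ]` exactly, the
  comparison domain is the unit disc `𝔻` at the finer mesh `δ/R` with marked points `0`, `p₁/R` and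
  the lattice point `(δ/R)·([(a+ε)/δ] - [a/δ])` (a marked point moving with the mesh — this is why the
  hypotheses are taken in the moving-point form); `R → ∞` plays the role of `Λ ↑ ℂ`.
* The continuum inputs are (2.23) in the only generality used: for a conformal `φ : Ω → ℍ`,
  `⟨σ_aσ_b⟩⁺_Ω · |b - a|^{1/4} → 1` and `𝓑_Ω(a;b) → 1` as `b → a`
  (`tendsto_twoPointPlusCHI_mul_rpow_norm`, `tendsto_bCHI_nhdsNE`: differentiability of `φ` at `a`,
  `φ'(a) ≠ 0`, and the explicit half-plane formulae (1.3)).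
* The squeeze: with tolerance `τ`, first `ε` then `R` are chosen by these continuum limits, and the
  lattice quantity, which depends on neither, is eventually pinched within `e` of `⟨σ_aσ_b⟩⁺_Ω`.

## References

* D. Chelkak, C. Hongler, K. Izyurov, Ann. of Math. (2) 181 (2015), 1087–1138; arXiv:1202.2838:
  Thm 1.1, Thm 1.7, Prop 2.20, Remark 2.21, eq. (2.23), Lemma 2.24, §2.9 (proof of Thm 1.1).
* S. Friedli, Y. Velenik, *Statistical Mechanics of Lattice Systems*, CUP (2017), Thm 3.17,
  Thm 3.20, Lemma 3.22, Exercise 3.12 (GKS, volume monotonicity, translation invariance).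
-/

noncomputable section

open MeasureTheory Filter Topology Real Metric Set
open Literature.Probability.LatticeModels

namespace Literature.Probability.LatticeModels


/-! ### Lattice input: the graph `Ω_δ` versus `ℤ²`, and the infinite-volume sandwich -/

section Lattice

/-- A free site of `Ω_δ` is joined in `Ω_δ` to each of its `ℤ²`-neighbours (definition of the
discrete boundary `meshBoundary`). [cite: ChelkakHonglerIzyurovAnnals2015, §1.2] -/
theorem discreteDomainGraph_adj_of_mem_interior {Ω : Set ℂ} {δ : ℝ} {v y : Site 2}
    (hv : v ∈ meshInteriorFinset Ω δ) (hy : (zdGraph 2).Adj v y) : (discreteDomainGraph Ω δ).Adj v y := by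
  classical
  unfold meshInteriorFinset at hv
  split_ifs at hv with h
  · rw [Finset.mem_filter, Set.Finite.mem_toFinset] at hv
    obtain ⟨hvD, hvB⟩ := hv
    by_contra hadj
    exact hvB ⟨hvD, y, hy, hadj⟩
  · simp at hv

/-- The edges of `Ω_δ` touching the free sites are exactly the edges of `ℤ²` touching them.
[cite: ChelkakHonglerIzyurovAnnals2015, §1.2] -/
theorem edgesTouching_discreteDomainGraph (Ω : Set ℂ) (δ : ℝ) :
    edgesTouching (discreteDomainGraph Ω δ) (meshInteriorFinset Ω δ) =
      edgesTouching (zdGraph 2) (meshInteriorFinset Ω δ) := by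
  ext e
  induction e using Sym2.ind with
  | _ p q =>
    simp only [mem_edgesTouching_iff, SimpleGraph.mem_edgeSet, Sym2.mem_iff]
    constructor
    · rintro ⟨he, x, hx, hxe⟩
      exact ⟨((discreteDomainGraph_le_meshGraph Ω δ).trans (meshGraph_le_zdGraph Ω δ)) he, x, hx, hxe⟩
    · rintro ⟨he, x, hx, hxe⟩
      refine ⟨?_, x, hx, hxe⟩
      rcases hxe with rfl | rfl
      · exact discreteDomainGraph_adj_of_mem_interior hx he
      · exact (discreteDomainGraph_adj_of_mem_interior hx he.symm).symm

/-- **The Ising measures of `Ω_δ` and of `ℤ²` in the volume of free sites coincide** (any boundary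
condition): the interaction edges are the same. [cite: ChelkakHonglerIzyurovAnnals2015, §1.2] -/
theorem isingExpect_discreteDomainGraph_eq (Ω : Set ℂ) (δ β h : ℝ) (bc : BoundaryCondition (Site 2))
    (f : SpinConfig (Site 2) → ℝ) :
    isingExpect (discreteDomainGraph Ω δ) (meshInteriorFinset Ω δ) β h bc f =
      isingExpect (zdGraph 2) (meshInteriorFinset Ω δ) β h bc f := by
  have hE : ∀ bc : BoundaryCondition (Site 2),
      interactionEdges (discreteDomainGraph Ω δ) (meshInteriorFinset Ω δ) bc =
        interactionEdges (zdGraph 2) (meshInteriorFinset Ω δ) bc := by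
    intro bc
    cases bc with
    | free => simp [interactionEdges, edgesIn, edgesTouching_discreteDomainGraph]
    | fixed η => simp [interactionEdges, edgesTouching_discreteDomainGraph]
  have hH : isingHamiltonian (discreteDomainGraph Ω δ) (meshInteriorFinset Ω δ) h bc =
      isingHamiltonian (zdGraph 2) (meshInteriorFinset Ω δ) h bc := by
    funext σ
    simp only [isingHamiltonian, hE]
  simp only [isingExpect, isingMeasure, hH]

/-- `nearestSite δ 0 = 0`. [folklore] -/
@[simp] theorem nearestSite_zero (δ : ℝ) : nearestSite δ 0 = 0 := by
  ext i; fin_cases i <;> simp [nearestSite]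

/-- Rounding is scale-invariant: `[(z/R)/(δ/R)] = [z/δ]`. [folklore] -/
theorem nearestSite_div (δ : ℝ) {R : ℝ} (hR : R ≠ 0) (z : ℂ) :
    nearestSite (δ / R) (z / R) = nearestSite δ z := by
  ext i
  fin_cases i <;>
    simp [nearestSite, Complex.div_ofReal_re, Complex.div_ofReal_im, div_div_div_cancel_right₀ hR]

/-- **Translation invariance**: `⟨σ_xσ_y⟩_{ℤ²} = ⟨σ_0σ_{y-x}⟩_{ℤ²}` for the critical plus state.
[cite: FriedliVelenik2017, Thm. 3.17] -/
theorem plusCorr_pair_eq_twoPointPlus {x y : Site 2} (hxy : x ≠ y) :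
    plusCorr 2 criticalBetaTwo 0 {x, y} = twoPointPlus 2 criticalBetaTwo (y - x) := by
  have hne : y - x ≠ 0 := sub_ne_zero.2 hxy.symm
  rw [twoPointPlus_eq_plusCorr_pair _ hne,
    ← plusCorr_shift 2 criticalBetaTwo_pos.le le_rfl x ({0, y - x} : Finset (Site 2))]
  congr 1
  simp [Finset.map_insert]

/-- **`𝔼_{ℤ²} ≤ 𝔼⁺_Λ`** for every finite volume `Λ` (GKS: the plus state is the decreasing limit of
finite-volume `+` states, and these decrease in the volume). [cite: FriedliVelenik2017, Lemma 3.22 and Exercise 3.12] -/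
theorem plusCorr_le_isingCorr_plus (Λ A : Finset (Site 2)) :
    plusCorr 2 criticalBetaTwo 0 A ≤ isingCorr (zdGraph 2) Λ criticalBetaTwo 0 .plus A := by
  obtain ⟨L₀, hL₀⟩ := exists_forall_subset_box 2 (A ∪ Λ)
  have hAL : A ⊆ box 2 L₀ := Finset.subset_union_left.trans (hL₀ L₀ le_rfl)
  have hΛL : Λ ⊆ box 2 L₀ := Finset.subset_union_right.trans (hL₀ L₀ le_rfl)
  exact (plusCorr_le_isingCorr_plus_box criticalBetaTwo_pos.le le_rfl hAL).trans
    (isingCorr_plus_le_of_subset_right (zdGraph 2) criticalBetaTwo_pos.le le_rfl hAL hΛL)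

/-- **`𝔼^free_Λ ≤ 𝔼_{ℤ²}`** for `A ⊆ Λ` (GKS: free correlations increase in the volume to the free
state, which is dominated by the plus state). [cite: FriedliVelenik2017, Exercise 3.16 and Exercise 3.25] -/
theorem isingCorr_free_le_plusCorr {Λ A : Finset (Site 2)} (hA : A ⊆ Λ) :
    isingCorr (zdGraph 2) Λ criticalBetaTwo 0 .free A ≤ plusCorr 2 criticalBetaTwo 0 A := by
  obtain ⟨L₀, hL₀⟩ := exists_forall_subset_box 2 Λ
  have hΛL : Λ ⊆ box 2 L₀ := hL₀ L₀ le_rfl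
  calc isingCorr (zdGraph 2) Λ criticalBetaTwo 0 .free A
      ≤ isingCorr (zdGraph 2) (box 2 L₀) criticalBetaTwo 0 .free A :=
        isingCorr_free_le_of_subset (zdGraph 2) criticalBetaTwo_pos.le le_rfl hA hΛL
    _ ≤ freeCorr 2 criticalBetaTwo 0 A :=
        isingCorr_free_box_le_freeCorr criticalBetaTwo_pos.le le_rfl (hA.trans hΛL)
    _ ≤ plusCorr 2 criticalBetaTwo 0 A := freeCorr_le_plusCorr criticalBetaTwo_pos.le le_rfl A

/-- **Upper half of CHI's sandwich `𝔼^free_Λ ≤ 𝔼_ℂ ≤ 𝔼⁺_Ω`** (§2.9, proof of Lemma 2.24), in the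
tree's conventions: `⟨σ_0σ_{[c/δ]-[a/δ]}⟩_{ℤ²} ≤ 𝔼⁺_{Ω_δ}[σ_aσ_c]` whenever the two rounded sites
differ (no membership needed: spins off the free sites are frozen to `+1` on both sides).
[cite: ChelkakHonglerIzyurovAnnals2015, §2.9, proof of Lemma 2.24] -/
theorem twoPointPlus_le_meshIsingPlusCorr_two (Ω : Set ℂ) (δ : ℝ) {a c : ℂ}
    (h : nearestSite δ a ≠ nearestSite δ c) :
    twoPointPlus 2 criticalBetaTwo (nearestSite δ c - nearestSite δ a) ≤ meshIsingPlusCorr Ω δ ![a, c] := by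
  rw [meshIsingPlusCorr_two_eq Ω δ h, ← plusCorr_pair_eq_twoPointPlus h]
  unfold isingCorr
  rw [isingExpect_discreteDomainGraph_eq]
  exact plusCorr_le_isingCorr_plus _ _

/-- **Lower half of CHI's sandwich `𝔼^free_Λ ≤ 𝔼_ℂ ≤ 𝔼⁺_Ω`** (§2.9, proof of Lemma 2.24), in the
tree's conventions: `𝔼^free_{Ω_δ}[σ_aσ_c] ≤ ⟨σ_0σ_{[c/δ]-[a/δ]}⟩_{ℤ²}` once both rounded sites are
free and distinct. [cite: ChelkakHonglerIzyurovAnnals2015, §2.9, proof of Lemma 2.24] -/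
theorem meshIsingFreeCorr_two_le_twoPointPlus {Ω : Set ℂ} {δ : ℝ} {a c : ℂ}
    (ha : nearestSite δ a ∈ meshInteriorFinset Ω δ) (hc : nearestSite δ c ∈ meshInteriorFinset Ω δ)
    (h : nearestSite δ a ≠ nearestSite δ c) :
    meshIsingFreeCorr Ω δ ![a, c] ≤ twoPointPlus 2 criticalBetaTwo (nearestSite δ c - nearestSite δ a) := by
  rw [meshIsingFreeCorr_two_eq Ω δ h, ← plusCorr_pair_eq_twoPointPlus h]
  unfold isingCorr
  rw [isingExpect_discreteDomainGraph_eq]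
  refine isingCorr_free_le_plusCorr ?_
  intro z hz
  simp only [Finset.mem_insert, Finset.mem_singleton] at hz
  rcases hz with rfl | rfl
  · exact ha
  · exact hc


/-- `ϱ(δ) = ⟨σ_0 σ_{[p₁/δ]}⟩_{ℤ²}` (unfolding). [cite: ChelkakHonglerIzyurovAnnals2015, §1.1] -/
theorem rhoCHI_eq (δ : ℝ) : rhoCHI δ = twoPointPlus 2 criticalBetaTwo (nearestSite δ (Complex.mk (Real.sqrt 2 / 2) (Real.sqrt 2 / 2))) := rfl

/-- `|p₁| = 1`. [cite: ChelkakHonglerIzyurovAnnals2015, §1.1] -/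
theorem norm_pOne_CHI : ‖(Complex.mk (Real.sqrt 2 / 2) (Real.sqrt 2 / 2))‖ = 1 := by
  have h2 : Real.sqrt 2 * Real.sqrt 2 = 2 := Real.mul_self_sqrt (by norm_num)
  have hsq : ‖(Complex.mk (Real.sqrt 2 / 2) (Real.sqrt 2 / 2))‖ ^ 2 = 1 := by
    rw [Complex.sq_norm, Complex.normSq_mk]
    nlinarith
  have h0 : 0 ≤ ‖(Complex.mk (Real.sqrt 2 / 2) (Real.sqrt 2 / 2))‖ := norm_nonneg _
  nlinarith

/-- `p₁ ≠ 0`. [cite: ChelkakHonglerIzyurovAnnals2015, §1.1] -/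
theorem pOne_ne_zero_CHI : (Complex.mk (Real.sqrt 2 / 2) (Real.sqrt 2 / 2)) ≠ 0 := by
  intro h
  have h1 := norm_pOne_CHI
  rw [h, norm_zero] at h1
  exact zero_ne_one h1

/-- `ϱ(δ) > 0` (GKS: the critical plus-state two-point function of `ℤ²` is positive).
[cite: FriedliVelenik2017, Thm. 3.20] -/
theorem rhoCHI_pos (δ : ℝ) : 0 < rhoCHI δ := by
  rw [rhoCHI_eq]
  exact twoPointPlus_pos criticalBetaTwo_pos _

end Lattice

/-! ### Marked points moving with the mesh -/

section Moving

/-- **Moving marked points are eventually free sites**: if `y(δ) → y₀ ∈ Ω` as `δ → 0⁺`, then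
`[y(δ)/δ]` is a free site of `Ω_δ` for all small `δ` (bulk clause of `MeshApproximates` on a closed
ball about `y₀`). [cite: ChelkakHonglerIzyurovAnnals2015, §2.1] -/
theorem eventually_nearestSite_mem_of_tendsto {Ω : Set ℂ} (hΩo : IsOpen Ω) (hM : MeshApproximates Ω)
    {y : ℝ → ℂ} {y₀ : ℂ} (hy₀ : y₀ ∈ Ω) (hy : Tendsto y (𝓝[>] 0) (𝓝 y₀)) :
    ∀ᶠ δ in 𝓝[>] (0 : ℝ), nearestSite δ (y δ) ∈ meshInteriorFinset Ω δ := by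
  obtain ⟨r, hr, hball⟩ := Metric.isOpen_iff.1 hΩo y₀ hy₀
  have hK : IsCompact (closedBall y₀ (r / 2)) := isCompact_closedBall _ _
  have hKΩ : closedBall y₀ (r / 2) ⊆ Ω := (closedBall_subset_ball (by linarith)).trans hball
  have h := hM.2.2 _ hK hKΩ
  have hyK : ∀ᶠ δ in 𝓝[>] (0 : ℝ), y δ ∈ closedBall y₀ (r / 2) :=
    hy (closedBall_mem_nhds _ (by positivity))
  filter_upwards [h, hyK, self_mem_nhdsWithin] with δ hδ hyδ hδ0
  exact Finset.mem_coe.1 (mem_of_mem_meshPolygon hδ0 (hδ hyδ) (mem_meshCell_nearestSite hδ0 _))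

/-- Distinct limit points round to distinct sites for small `δ` (one point moving). [folklore] -/
theorem eventually_nearestSite_ne_of_tendsto {x : ℂ} {y : ℝ → ℂ} {y₀ : ℂ} (h : y₀ ≠ x)
    (hy : Tendsto y (𝓝[>] 0) (𝓝 y₀)) :
    ∀ᶠ δ in 𝓝[>] (0 : ℝ), nearestSite δ x ≠ nearestSite δ (y δ) := by
  have hd : 0 < dist y₀ x / 4 := div_pos (dist_pos.2 h) (by norm_num)
  have hev : ∀ᶠ δ in 𝓝[>] (0 : ℝ), δ < dist y₀ x / 4 :=
    mem_nhdsWithin_of_mem_nhds (Iio_mem_nhds hd)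
  have hyev : ∀ᶠ δ in 𝓝[>] (0 : ℝ), dist (y δ) y₀ < dist y₀ x / 4 :=
    hy (ball_mem_nhds _ hd)
  filter_upwards [hev, hyev, self_mem_nhdsWithin] with δ hδ hyδ hδ0 heq
  have hδ0' : (0 : ℝ) < δ := hδ0
  have h1 := dist_meshPoint_nearestSite_le hδ0' x
  have h2 := dist_meshPoint_nearestSite_le hδ0' (y δ)
  rw [heq] at h1
  have h3 := dist_triangle_left x (y δ) (meshPoint δ (nearestSite δ (y δ)))
  have h4 := dist_triangle y₀ (y δ) x
  rw [dist_comm y₀ (y δ)] at h4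
  have h5 : dist (y δ) x = dist x (y δ) := dist_comm _ _
  linarith

/-- The lattice displacement between two rounded marked points, rescaled, converges:
`δ · ([c/δ] - [a/δ]) → c - a`. [folklore] -/
theorem tendsto_meshPoint_nearestSite_sub (a c : ℂ) :
    Tendsto (fun δ => meshPoint δ (nearestSite δ c - nearestSite δ a)) (𝓝[>] 0) (𝓝 (c - a)) := by
  rw [Metric.tendsto_nhds]
  intro e he
  have hev : ∀ᶠ δ in 𝓝[>] (0 : ℝ), δ < e / 2 := mem_nhdsWithin_of_mem_nhds (Iio_mem_nhds (by positivity))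
  filter_upwards [hev, self_mem_nhdsWithin] with δ hδ hδ0
  have hδ0' : (0 : ℝ) < δ := hδ0
  have hsub : meshPoint δ (nearestSite δ c - nearestSite δ a) =
      meshPoint δ (nearestSite δ c) - meshPoint δ (nearestSite δ a) := by
    apply Complex.ext <;> simp [mul_sub]
  rw [hsub, dist_eq_norm]
  have h1 := dist_meshPoint_nearestSite_le hδ0' c
  have h2 := dist_meshPoint_nearestSite_le hδ0' a
  rw [dist_eq_norm] at h1 h2
  calc ‖meshPoint δ (nearestSite δ c) - meshPoint δ (nearestSite δ a) - (c - a)‖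
      = ‖(meshPoint δ (nearestSite δ c) - c) - (meshPoint δ (nearestSite δ a) - a)‖ := by ring_nf
    _ ≤ ‖meshPoint δ (nearestSite δ c) - c‖ + ‖meshPoint δ (nearestSite δ a) - a‖ := norm_sub_le _ _
    _ < e := by linarith

end Moving

/-! ### Continuum input: the explicit functions as the two points merge (CHI (2.23)) -/

section Continuum

/-- The algebra behind `⟨σ_aσ_b⟩⁺ |b-a|^{1/4} → 1`: with `u = √(N/D)`,
`√(u + u⁻¹) · t^{1/4} = √((N/D + 1) · √(t D / N))`. [cite: ChelkakHonglerIzyurovAnnals2015, eq. (1.3)] -/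
theorem sqrt_uCHI_aux {N D t : ℝ} (hN : 0 < N) (hD : 0 < D) (ht : 0 < t) :
    Real.sqrt ((N / D) ^ ((1 : ℝ) / 2) + ((N / D) ^ ((1 : ℝ) / 2))⁻¹) * t ^ ((1 : ℝ) / 4) =
      Real.sqrt ((N / D + 1) * Real.sqrt (t * D / N)) := by
  set r : ℝ := N / D with hr
  have hr0 : 0 < r := div_pos hN hD
  have hsr : 0 < Real.sqrt r := Real.sqrt_pos.2 hr0
  rw [← Real.sqrt_eq_rpow]
  have h1 : Real.sqrt r + (Real.sqrt r)⁻¹ = (r + 1) / Real.sqrt r := by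
    field_simp
    rw [Real.sq_sqrt hr0.le]
  have h2 : t ^ ((1 : ℝ) / 4) = Real.sqrt (Real.sqrt t) := by
    rw [Real.sqrt_eq_rpow, Real.sqrt_eq_rpow, ← Real.rpow_mul ht.le]
    norm_num
  have h3 : t * D / N = t / r := by
    rw [hr]
    field_simp
  rw [h1, h2, h3, ← Real.sqrt_mul (div_nonneg (by linarith) hsr.le), Real.sqrt_div' t hr0.le]
  congr 1
  ring

/-- **CHI (2.23), special case of a fixed domain and merging points**: for a conformal bijection
`φ : Ω → ℍ` (`Ω` open) and `a ∈ Ω`, the explicit continuum two-point function satisfies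
`⟨σ_aσ_b⟩⁺_Ω · |b - a|^{1/4} → 1 = ⟨σ_aσ_b⟩_ℂ |b-a|^{1/4}` as `b → a` ("by standard estimates for
conformal maps … `φ(b) → φ(a)` and `|φ'(b)| → |φ'(a)|`. Hence, the explicit formula (1.3) imply …
`→ 1`"). [cite: ChelkakHonglerIzyurovAnnals2015, eq. (2.23) and its proof, §2.9] -/
theorem tendsto_twoPointPlusCHI_mul_rpow_norm {Ω : Set ℂ} (hΩo : IsOpen Ω) {φ : ℂ → ℂ}
    (hφ : IsConformalBijection φ Ω UpperHalfPlane.upperHalfPlaneSet) {a : ℂ} (ha : a ∈ Ω) :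
    Tendsto (fun b => twoPointPlusCHI φ a b * ‖b - a‖ ^ ((1 : ℝ) / 4)) (𝓝[≠] a) (𝓝 1) := by
  have hφa : 0 < (φ a).im := hφ.2.mapsTo ha
  have hda : deriv φ a ≠ 0 :=
    Literature.Analysis.Complex.SCV.deriv_ne_zero_of_injOn hφ.1 hΩo hφ.2.injOn ha
  set d : ℝ := ‖deriv φ a‖ with hd_def
  set m : ℝ := 2 * (φ a).im with hm_def
  have hd : 0 < d := norm_pos_iff.2 hda
  have hm : 0 < m := by positivity
  have hdiff : DifferentiableAt ℂ φ a := hφ.1.differentiableAt (hΩo.mem_nhds ha)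
  have hcont : Tendsto φ (𝓝[≠] a) (𝓝 (φ a)) := hdiff.continuousAt.tendsto.mono_left nhdsWithin_le_nhds
  -- (1) slope
  have h1 : Tendsto (fun b => ‖φ b - φ a‖ / ‖b - a‖) (𝓝[≠] a) (𝓝 d) := by
    have hs : Tendsto (slope φ a) (𝓝[≠] a) (𝓝 (deriv φ a)) :=
      hasDerivAt_iff_tendsto_slope.1 hdiff.hasDerivAt
    refine hs.norm.congr' ?_
    filter_upwards [self_mem_nhdsWithin] with b hb
    rw [slope_def_field, norm_div]
  -- (2) distance to the mirror image
  have h2 : Tendsto (fun b => ‖φ b - (starRingEnd ℂ) (φ a)‖) (𝓝[≠] a) (𝓝 m) := by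
    have h := (hcont.sub (tendsto_const_nhds (x := (starRingEnd ℂ) (φ a)))).norm
    have hval : ‖φ a - (starRingEnd ℂ) (φ a)‖ = m := by
      have : φ a - (starRingEnd ℂ) (φ a) = ((2 * (φ a).im : ℝ) : ℂ) * Complex.I := by
        apply Complex.ext
        · simp
        · simp [two_mul]
      rw [this, norm_mul, Complex.norm_real, Complex.norm_I, mul_one, Real.norm_eq_abs,
        abs_of_pos hm]
    rwa [hval] at h
  -- (3) imaginary parts and derivatives
  have h3 : Tendsto (fun b => 2 * (φ b).im) (𝓝[≠] a) (𝓝 m) :=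
    (Complex.continuous_im.tendsto _ |>.comp hcont).const_mul 2
  have h4 : Tendsto (fun b => ‖deriv φ b‖) (𝓝[≠] a) (𝓝 d) := by
    have han : AnalyticOnNhd ℂ φ Ω := hφ.1.analyticOnNhd hΩo
    have hc : ContinuousAt (deriv φ) a := (han.deriv a ha).continuousAt
    exact (hc.tendsto.mono_left nhdsWithin_le_nhds).norm
  -- (4) eventual side conditions
  have hev : ∀ᶠ b in 𝓝[≠] a, b ∈ Ω ∧ b ≠ a := by
    filter_upwards [mem_nhdsWithin_of_mem_nhds (hΩo.mem_nhds ha), self_mem_nhdsWithin] with b hb hba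
    exact ⟨hb, hba⟩
  -- (5) `s b → m / d`
  have h5 : Tendsto (fun b => ‖b - a‖ * ‖φ b - (starRingEnd ℂ) (φ a)‖ / ‖φ b - φ a‖) (𝓝[≠] a)
      (𝓝 (m / d)) := by
    refine (h2.div h1 hd.ne').congr' ?_
    filter_upwards [hev] with b hb
    have hba : ‖b - a‖ ≠ 0 := norm_ne_zero_iff.2 (sub_ne_zero.2 hb.2)
    have hN : ‖φ b - φ a‖ ≠ 0 :=
      norm_ne_zero_iff.2 (sub_ne_zero.2 fun h => hb.2 (hφ.2.injOn hb.1 ha h))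
    simp only [Pi.div_apply]
    field_simp
  -- (6) `r b → 0`
  have h6 : Tendsto (fun b => ‖φ b - φ a‖ / ‖φ b - (starRingEnd ℂ) (φ a)‖) (𝓝[≠] a) (𝓝 0) := by
    have hnum : Tendsto (fun b => ‖φ b - φ a‖) (𝓝[≠] a) (𝓝 0) := by
      have h := (hcont.sub (tendsto_const_nhds (x := φ a))).norm
      rwa [sub_self, norm_zero] at h
    have h := hnum.div h2 hm.ne'
    rwa [zero_div] at h
  -- (7) the identity
  have hId : ∀ᶠ b in 𝓝[≠] a,
      Real.sqrt ((‖φ b - φ a‖ / ‖φ b - (starRingEnd ℂ) (φ a)‖ + 1) *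
          Real.sqrt (‖b - a‖ * ‖φ b - (starRingEnd ℂ) (φ a)‖ / ‖φ b - φ a‖)) *
        ((m ^ ((1 : ℝ) / 8) * (2 * (φ b).im) ^ ((1 : ℝ) / 8))⁻¹ *
          (d ^ ((1 : ℝ) / 8) * ‖deriv φ b‖ ^ ((1 : ℝ) / 8))) =
      twoPointPlusCHI φ a b * ‖b - a‖ ^ ((1 : ℝ) / 4) := by
    filter_upwards [hev] with b hb
    have hN : 0 < ‖φ b - φ a‖ :=
      norm_pos_iff.2 (sub_ne_zero.2 fun h => hb.2 (hφ.2.injOn hb.1 ha h))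
    have hφb : 0 < (φ b).im := hφ.2.mapsTo hb.1
    have hD : 0 < ‖φ b - (starRingEnd ℂ) (φ a)‖ := by
      refine norm_pos_iff.2 (sub_ne_zero.2 fun h => ?_)
      have h' := congrArg Complex.im h
      rw [Complex.conj_im] at h'
      linarith
    have ht : 0 < ‖b - a‖ := norm_pos_iff.2 (sub_ne_zero.2 hb.2)
    have key := sqrt_uCHI_aux hN hD ht
    unfold twoPointPlusCHI uCHI
    rw [← key]
    ring
  -- (8) the limit of the left-hand side of the identity
  have hlim : Tendsto (fun b =>
      Real.sqrt ((‖φ b - φ a‖ / ‖φ b - (starRingEnd ℂ) (φ a)‖ + 1) *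
          Real.sqrt (‖b - a‖ * ‖φ b - (starRingEnd ℂ) (φ a)‖ / ‖φ b - φ a‖)) *
        ((m ^ ((1 : ℝ) / 8) * (2 * (φ b).im) ^ ((1 : ℝ) / 8))⁻¹ *
          (d ^ ((1 : ℝ) / 8) * ‖deriv φ b‖ ^ ((1 : ℝ) / 8)))) (𝓝[≠] a)
      (𝓝 (Real.sqrt ((0 + 1) * Real.sqrt (m / d)) *
        ((m ^ ((1 : ℝ) / 8) * m ^ ((1 : ℝ) / 8))⁻¹ * (d ^ ((1 : ℝ) / 8) * d ^ ((1 : ℝ) / 8))))) := by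
    refine (((h6.add tendsto_const_nhds).mul h5.sqrt).sqrt).mul ((Tendsto.inv₀ ?_ ?_).mul ?_)
    · exact tendsto_const_nhds.mul (h3.rpow_const (Or.inr (by norm_num)))
    · exact mul_ne_zero (Real.rpow_pos_of_pos hm _).ne' (Real.rpow_pos_of_pos hm _).ne'
    · exact tendsto_const_nhds.mul (h4.rpow_const (Or.inr (by norm_num)))
  have hval : Real.sqrt ((0 + 1) * Real.sqrt (m / d)) *
      ((m ^ ((1 : ℝ) / 8) * m ^ ((1 : ℝ) / 8))⁻¹ * (d ^ ((1 : ℝ) / 8) * d ^ ((1 : ℝ) / 8))) = 1 := by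
    rw [zero_add, one_mul, ← Real.rpow_add hm, ← Real.rpow_add hd, Real.sqrt_eq_rpow,
      Real.sqrt_eq_rpow, ← Real.rpow_mul (div_nonneg hm.le hd.le),
      Real.div_rpow hm.le hd.le]
    norm_num
    field_simp
  have h := hlim.congr' hId
  rwa [hval] at h

/-- The function `u ↦ √(u⁻¹ - u)/√(u + u⁻¹)` (CHI's `𝓑` as a function of `u`) tends to `1` as
`u → 0⁺`. [cite: ChelkakHonglerIzyurovAnnals2015, eq. (1.3) and Remark 2.23] -/
theorem tendsto_bCHI_aux_zero :
    Tendsto (fun u : ℝ => Real.sqrt (u⁻¹ - u) / Real.sqrt (u + u⁻¹)) (𝓝[>] 0) (𝓝 1) := by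
  have hlim : Tendsto (fun u : ℝ => Real.sqrt (1 - u ^ 2) / Real.sqrt (1 + u ^ 2)) (𝓝 0) (𝓝 1) := by
    have hc : Continuous fun u : ℝ => Real.sqrt (1 - u ^ 2) / Real.sqrt (1 + u ^ 2) := by
      refine Continuous.div (by fun_prop) (by fun_prop) fun u => ?_
      exact (Real.sqrt_pos.2 (by positivity)).ne'
    simpa using hc.tendsto 0
  refine (hlim.mono_left nhdsWithin_le_nhds).congr' ?_
  filter_upwards [self_mem_nhdsWithin] with u hu
  have hu0 : (0 : ℝ) < u := hu
  have hsu : 0 < Real.sqrt u := Real.sqrt_pos.2 hu0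
  have e1 : u⁻¹ - u = (1 - u ^ 2) / u := by field_simp
  have e2 : u + u⁻¹ = (1 + u ^ 2) / u := by field_simp; ring
  rw [e1, e2, Real.sqrt_div' _ hu0.le, Real.sqrt_div' _ hu0.le, div_div_div_cancel_right₀ hsu.ne']

/-- `u(w, w) = 0`. [cite: ChelkakHonglerIzyurovAnnals2015, eq. (1.3)] -/
theorem uCHI_self (w : ℂ) : uCHI w w = 0 := by
  unfold uCHI
  rw [sub_self, norm_zero, zero_div, Real.zero_rpow (by norm_num)]

/-- **CHI Remark 2.23, special case of a fixed domain and merging points**: `𝓑_Ω(a;b) → 1` as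
`b → a` ("`𝓑_Ω(a;b) → 1` as `𝒟_Ω(a;b) → 0` … follows readily from the conformal invariance of `𝓑`
and the explicit formulae in the half-plane"), for a conformal bijection `φ : Ω → ℍ`.
[cite: ChelkakHonglerIzyurovAnnals2015, Remark 2.23] -/
theorem tendsto_bCHI_nhdsNE {Ω : Set ℂ} (hΩo : IsOpen Ω) {φ : ℂ → ℂ}
    (hφ : IsConformalBijection φ Ω UpperHalfPlane.upperHalfPlaneSet) {a : ℂ} (ha : a ∈ Ω) :
    Tendsto (fun b => bCHI (φ a) (φ b)) (𝓝[≠] a) (𝓝 1) := by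
  have hφa : 0 < (φ a).im := hφ.2.mapsTo ha
  have hdiff : DifferentiableAt ℂ φ a := hφ.1.differentiableAt (hΩo.mem_nhds ha)
  have hcont : Tendsto φ (𝓝[≠] a) (𝓝 (φ a)) := hdiff.continuousAt.tendsto.mono_left nhdsWithin_le_nhds
  have hq : φ a ≠ (starRingEnd ℂ) (φ a) := fun h => by
    have h' := congrArg Complex.im h
    rw [Complex.conj_im] at h'
    linarith
  have hu : Tendsto (fun b => uCHI (φ a) (φ b)) (𝓝[≠] a) (𝓝 0) := by
    have h := tendsto_uCHI tendsto_const_nhds hcont hq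
    rwa [uCHI_self] at h
  have hpos : ∀ᶠ b in 𝓝[≠] a, 0 < uCHI (φ a) (φ b) := by
    filter_upwards [mem_nhdsWithin_of_mem_nhds (hΩo.mem_nhds ha), self_mem_nhdsWithin] with b hb hba
    refine uCHI_pos (fun h => hba (hφ.2.injOn hb ha h)) fun h => ?_
    have h' := congrArg Complex.im h
    rw [Complex.conj_im] at h'
    have hφb : 0 < (φ b).im := hφ.2.mapsTo hb
    linarith
  have hu' : Tendsto (fun b => uCHI (φ a) (φ b)) (𝓝[≠] a) (𝓝[>] 0) :=
    tendsto_nhdsWithin_iff.2 ⟨hu, hpos⟩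
  exact tendsto_bCHI_aux_zero.comp hu'

/-- `0 < 𝓑 ≤ 1` is not needed; we record `𝓑_Ω(a;b) > 0` for `b ≠ a` close to `a` through the
limit. Positivity of the explicit `+` two-point function (`u > 0`).
[cite: ChelkakHonglerIzyurovAnnals2015, eq. (1.3)] -/
theorem twoPointPlusCHI_pos' {Ω : Set ℂ} (hΩo : IsOpen Ω) {φ : ℂ → ℂ}
    (hφ : IsConformalBijection φ Ω UpperHalfPlane.upperHalfPlaneSet) {a b : ℂ} (ha : a ∈ Ω)
    (hb : b ∈ Ω) (hab : a ≠ b) : 0 < twoPointPlusCHI φ a b := by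
  have hφa : 0 < (φ a).im := hφ.2.mapsTo ha
  have hφb : 0 < (φ b).im := hφ.2.mapsTo hb
  have hw1 : φ b ≠ φ a := fun h => hab (hφ.2.injOn ha hb h.symm)
  have hw2 : φ b ≠ (starRingEnd ℂ) (φ a) := fun h => by
    have h' := congrArg Complex.im h
    rw [Complex.conj_im] at h'
    linarith
  have hda : deriv φ a ≠ 0 :=
    Literature.Analysis.Complex.SCV.deriv_ne_zero_of_injOn hφ.1 hΩo hφ.2.injOn ha
  have hdb : deriv φ b ≠ 0 :=
    Literature.Analysis.Complex.SCV.deriv_ne_zero_of_injOn hφ.1 hΩo hφ.2.injOn hb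
  rw [twoPointPlusCHI_eq_mul_ratioCHI hφa hφb]
  exact mul_pos (mul_pos (onePointPlusCHI_pos hda hφa) (onePointPlusCHI_pos hdb hφb))
    (lt_of_lt_of_le one_pos (one_le_ratioCHI hw1 hw2))

/-- `𝓑_Ω(a;b) > 0` for distinct `a, b`. [cite: ChelkakHonglerIzyurovAnnals2015, Thm. 1.7 and eq. (1.3)] -/
theorem bCHI_pos {Ω : Set ℂ} {φ : ℂ → ℂ}
    (hφ : IsConformalBijection φ Ω UpperHalfPlane.upperHalfPlaneSet) {a b : ℂ} (ha : a ∈ Ω)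
    (hb : b ∈ Ω) (hab : a ≠ b) : 0 < bCHI (φ a) (φ b) := by
  have hφa : 0 < (φ a).im := hφ.2.mapsTo ha
  have hφb : 0 < (φ b).im := hφ.2.mapsTo hb
  have hw1 : φ b ≠ φ a := fun h => hab (hφ.2.injOn ha hb h.symm)
  have hw2 : φ b ≠ (starRingEnd ℂ) (φ a) := fun h => by
    have h' := congrArg Complex.im h
    rw [Complex.conj_im] at h'
    linarith
  have hu := uCHI_pos hw1 hw2
  -- `u < 1` in the upper half-plane: `|w₂ - w₁| < |w₂ - w̄₁|`
  have hu1 : uCHI (φ a) (φ b) < 1 := by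
    unfold uCHI
    have hlt : ‖φ b - φ a‖ < ‖φ b - (starRingEnd ℂ) (φ a)‖ := by
      rw [← sq_lt_sq₀ (norm_nonneg _) (norm_nonneg _), Complex.sq_norm, Complex.sq_norm,
        Complex.normSq_apply, Complex.normSq_apply]
      simp only [Complex.sub_re, Complex.sub_im, Complex.conj_re, Complex.conj_im]
      nlinarith
    have hD : 0 < ‖φ b - (starRingEnd ℂ) (φ a)‖ := lt_of_le_of_lt (norm_nonneg _) hlt
    have hlt' : ‖φ b - φ a‖ / ‖φ b - (starRingEnd ℂ) (φ a)‖ < 1 := (div_lt_one hD).2 hlt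
    calc (‖φ b - φ a‖ / ‖φ b - (starRingEnd ℂ) (φ a)‖) ^ ((1 : ℝ) / 2)
        < (1 : ℝ) ^ ((1 : ℝ) / 2) :=
          Real.rpow_lt_rpow (div_nonneg (norm_nonneg _) (norm_nonneg _)) hlt' (by norm_num)
      _ = 1 := Real.one_rpow _
  unfold bCHI
  have hnum : 0 < Real.sqrt ((uCHI (φ a) (φ b))⁻¹ - uCHI (φ a) (φ b)) := by
    apply Real.sqrt_pos.2
    have : 1 < (uCHI (φ a) (φ b))⁻¹ := (one_lt_inv₀ hu).2 hu1
    linarith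
  have hden : 0 < Real.sqrt (uCHI (φ a) (φ b) + (uCHI (φ a) (φ b))⁻¹) :=
    Real.sqrt_pos.2 (by positivity)
  exact div_pos hnum hden

end Continuum

/-! ### CHI §2.9: Theorem 1.1 from the ratios -/

section Main

/-- A path into the punctured neighbourhood filter: `ε ↦ a + ε`, `ε → 0⁺`. [folklore] -/
theorem tendsto_add_ofReal_nhdsNE (a : ℂ) :
    Tendsto (fun ε : ℝ => a + (ε : ℂ)) (𝓝[>] 0) (𝓝[≠] a) := by
  refine tendsto_nhdsWithin_iff.2 ⟨?_, ?_⟩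
  · have h : Tendsto (fun ε : ℝ => a + (ε : ℂ)) (𝓝 0) (𝓝 (a + ((0 : ℝ) : ℂ))) :=
      tendsto_const_nhds.add (Complex.continuous_ofReal.tendsto 0)
    rw [Complex.ofReal_zero, add_zero] at h
    exact h.mono_left nhdsWithin_le_nhds
  · filter_upwards [self_mem_nhdsWithin] with ε hε
    have hε0 : (0 : ℝ) < ε := hε
    show a + (ε : ℂ) ≠ a
    intro h
    have h' := congrArg Complex.re h
    simp only [Complex.add_re, Complex.ofReal_re] at h'
    linarith

/-- A path into the punctured neighbourhood filter of `0`: `R ↦ w / R`, `R → ∞` (`w ≠ 0`). [folklore] -/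
theorem tendsto_div_ofReal_atTop_nhdsNE {w : ℂ} (hw : w ≠ 0) :
    Tendsto (fun R : ℝ => w / (R : ℂ)) atTop (𝓝[≠] 0) := by
  refine tendsto_nhdsWithin_iff.2 ⟨?_, ?_⟩
  · have h : Tendsto (fun R : ℝ => R⁻¹) atTop (𝓝 0) := tendsto_inv_atTop_zero
    have h' : Tendsto (fun R : ℝ => ((R⁻¹ : ℝ) : ℂ)) atTop (𝓝 0) := by
      have := (Complex.continuous_ofReal.tendsto 0).comp h
      rwa [Function.comp_def, Complex.ofReal_zero] at this
    have h'' := h'.const_mul w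
    rw [mul_zero] at h''
    refine h''.congr' (Eventually.of_forall fun R => ?_)
    simp [div_eq_mul_inv]
  · filter_upwards [eventually_gt_atTop 0] with R hR
    show w / (R : ℂ) ≠ 0
    exact div_ne_zero hw (by exact_mod_cast hR.ne')

/-- **CHI Theorem 1.1 (`+` boundary conditions) for one domain and one pair of points, from the
convergence of ratios of `+` two-point functions (CHI Prop. 2.20 & Remark 2.21, `k = 1`) and of the
free/plus ratios (CHI Thm. 1.7) — §2.9 of CHI, formalised.** Let `Ω` be admissible and
approximable (`MeshApproximates`), `φ : Ω → ℍ` and `c : 𝔻 → ℍ` conformal bijections, and assume,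
both for `(Ω, φ)` and for `(𝔻, c)`: for every marked point `x`, every limit point `y₀ ≠ x`, every
family of marked points `y(δ) → y₀` and every `y' ≠ x`,
* `hR`/`hRD` (Prop. 2.20): `𝔼⁺[σ_xσ_{y(δ)}] / 𝔼⁺[σ_xσ_{y'}] → ⟨σ_xσ_{y₀}⟩⁺ / ⟨σ_xσ_{y'}⟩⁺`
  (`twoPointPlusCHI`), and
* `hB`/`hBD` (Thm. 1.7): `𝔼^free[σ_xσ_{y(δ)}] / 𝔼⁺[σ_xσ_{y(δ)}] → 𝓑(x; y₀)` (`bCHI`).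
Then `𝔼⁺_{Ω_δ}[σ_aσ_b] / ϱ(δ) → ⟨σ_aσ_b⟩⁺_Ω` for all distinct `a, b ∈ Ω`. Proof: module docstring
(the FKG/GKS sandwich `𝔼^free ≤ 𝔼_{ℤ²} ≤ 𝔼⁺`, the disc at mesh `δ/R` as CHI's large domain `Λ`,
the limits (2.23) as the points merge, and the squeeze of p. 19).
[cite: ChelkakHonglerIzyurovAnnals2015, §2.9, proof of Thm. 1.1; Lemma 2.24; Prop. 2.20; Thm. 1.7] -/
theorem tendsto_twoPoint_rho_of_ratios {Ω : Set ℂ} (hΩ : IsAdmissibleDomain Ω)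
    (hM : MeshApproximates Ω) {φ : ℂ → ℂ}
    (hφ : IsConformalBijection φ Ω UpperHalfPlane.upperHalfPlaneSet) {c : ℂ → ℂ}
    (hc : IsConformalBijection c (ball (0 : ℂ) 1) UpperHalfPlane.upperHalfPlaneSet)
    (hR : ∀ x ∈ Ω, ∀ (y : ℝ → ℂ) (y₀ y' : ℂ), y₀ ∈ Ω → y' ∈ Ω → y₀ ≠ x → y' ≠ x →
      Tendsto y (𝓝[>] 0) (𝓝 y₀) →
        Tendsto (fun δ => meshIsingPlusCorr Ω δ ![x, y δ] / meshIsingPlusCorr Ω δ ![x, y'])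
          (𝓝[>] 0) (𝓝 (twoPointPlusCHI φ x y₀ / twoPointPlusCHI φ x y')))
    (hB : ∀ x ∈ Ω, ∀ (y : ℝ → ℂ) (y₀ : ℂ), y₀ ∈ Ω → y₀ ≠ x → Tendsto y (𝓝[>] 0) (𝓝 y₀) →
        Tendsto (fun δ => meshIsingFreeCorr Ω δ ![x, y δ] / meshIsingPlusCorr Ω δ ![x, y δ])
          (𝓝[>] 0) (𝓝 (bCHI (φ x) (φ y₀))))
    (hRD : ∀ x ∈ ball (0 : ℂ) 1, ∀ (y : ℝ → ℂ) (y₀ y' : ℂ), y₀ ∈ ball (0 : ℂ) 1 →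
      y' ∈ ball (0 : ℂ) 1 → y₀ ≠ x → y' ≠ x → Tendsto y (𝓝[>] 0) (𝓝 y₀) →
        Tendsto (fun δ => meshIsingPlusCorr (ball (0 : ℂ) 1) δ ![x, y δ] /
            meshIsingPlusCorr (ball (0 : ℂ) 1) δ ![x, y'])
          (𝓝[>] 0) (𝓝 (twoPointPlusCHI c x y₀ / twoPointPlusCHI c x y')))
    (hBD : ∀ x ∈ ball (0 : ℂ) 1, ∀ (y : ℝ → ℂ) (y₀ : ℂ), y₀ ∈ ball (0 : ℂ) 1 → y₀ ≠ x →
      Tendsto y (𝓝[>] 0) (𝓝 y₀) →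
        Tendsto (fun δ => meshIsingFreeCorr (ball (0 : ℂ) 1) δ ![x, y δ] /
            meshIsingPlusCorr (ball (0 : ℂ) 1) δ ![x, y δ])
          (𝓝[>] 0) (𝓝 (bCHI (c x) (c y₀))))
    {a b : ℂ} (ha : a ∈ Ω) (hb : b ∈ Ω) (hab : a ≠ b) :
    Tendsto (fun δ => meshIsingPlusCorr Ω δ ![a, b] / rhoCHI δ) (𝓝[>] 0)
      (𝓝 (twoPointPlusCHI φ a b)) := by
  have hΩo : IsOpen Ω := hΩ.1
  have hDo : IsOpen (ball (0 : ℂ) 1) := isOpen_ball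
  have h0D : (0 : ℂ) ∈ ball (0 : ℂ) 1 := mem_ball_self one_pos
  set M := twoPointPlusCHI φ a b with hMdef
  have hM0 : 0 < M := twoPointPlusCHI_pos' hΩo hφ ha hb hab
  rw [Metric.tendsto_nhds]
  intro e he
  /- Step 1: the tolerance `τ`. -/
  obtain ⟨τ, hτ0, hτ1, hτlo, hτhi⟩ : ∃ τ : ℝ, 0 < τ ∧ τ < 1 / 2 ∧
      M - e / 2 < M * ((1 - τ) ^ 2 / (1 + τ) ^ 2) ∧ M * ((1 + τ) / (1 - τ) ^ 4) < M + e / 2 := by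
    have hc1 : Tendsto (fun τ : ℝ => M * ((1 - τ) ^ 2 / (1 + τ) ^ 2)) (𝓝 0) (𝓝 M) := by
      have h : Tendsto (fun τ : ℝ => M * ((1 - τ) ^ 2 / (1 + τ) ^ 2)) (𝓝 0)
          (𝓝 (M * ((1 - 0) ^ 2 / (1 + 0) ^ 2))) :=
        (((tendsto_const_nhds.sub tendsto_id).pow 2).div ((tendsto_const_nhds.add tendsto_id).pow 2)
          (by norm_num)).const_mul M
      norm_num at h
      exact h
    have hc2 : Tendsto (fun τ : ℝ => M * ((1 + τ) / (1 - τ) ^ 4)) (𝓝 0) (𝓝 M) := by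
      have h : Tendsto (fun τ : ℝ => M * ((1 + τ) / (1 - τ) ^ 4)) (𝓝 0)
          (𝓝 (M * ((1 + 0) / (1 - 0) ^ 4))) :=
        ((tendsto_const_nhds.add tendsto_id).div ((tendsto_const_nhds.sub tendsto_id).pow 4)
          (by norm_num)).const_mul M
      norm_num at h
      exact h
    have e1 : ∀ᶠ τ in 𝓝[>] (0 : ℝ), M - e / 2 < M * ((1 - τ) ^ 2 / (1 + τ) ^ 2) :=
      mem_nhdsWithin_of_mem_nhds (hc1.eventually_const_lt (by linarith))
    have e2 : ∀ᶠ τ in 𝓝[>] (0 : ℝ), M * ((1 + τ) / (1 - τ) ^ 4) < M + e / 2 :=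
      mem_nhdsWithin_of_mem_nhds (hc2.eventually_lt_const (by linarith))
    have e3 : ∀ᶠ τ in 𝓝[>] (0 : ℝ), τ < 1 / 2 :=
      mem_nhdsWithin_of_mem_nhds (Iio_mem_nhds (by norm_num))
    have e0 : ∀ᶠ τ in 𝓝[>] (0 : ℝ), 0 < τ := self_mem_nhdsWithin
    obtain ⟨τ, h0, h3, h1, h2⟩ := (e0.and (e3.and (e1.and e2))).exists
    exact ⟨τ, h0, h3, h1, h2⟩
  have h1τ : 0 < 1 - τ := by linarith
  /- Step 2: the auxiliary scale `ε` (continuum limits in `Ω` as `a + ε → a`). -/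
  obtain ⟨ε, hε0, haε, hA3, hβΩ⟩ : ∃ ε : ℝ, 0 < ε ∧ a + (ε : ℂ) ∈ Ω ∧
      dist (twoPointPlusCHI φ a (a + ε) * ‖(a + ε) - a‖ ^ ((1 : ℝ) / 4)) 1 < τ ∧
      1 - τ < bCHI (φ a) (φ (a + ε)) := by
    have hp := tendsto_add_ofReal_nhdsNE a
    have e0 : ∀ᶠ ε : ℝ in 𝓝[>] 0, 0 < ε := self_mem_nhdsWithin
    have e1 : ∀ᶠ ε : ℝ in 𝓝[>] 0, a + (ε : ℂ) ∈ Ω :=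
      hp.eventually (mem_nhdsWithin_of_mem_nhds (hΩo.mem_nhds ha))
    have e2 : ∀ᶠ ε : ℝ in 𝓝[>] 0,
        dist (twoPointPlusCHI φ a (a + (ε : ℂ)) * ‖(a + (ε : ℂ)) - a‖ ^ ((1 : ℝ) / 4)) 1 < τ :=
      Metric.tendsto_nhds.1 ((tendsto_twoPointPlusCHI_mul_rpow_norm hΩo hφ ha).comp hp) τ hτ0
    have e3 : ∀ᶠ ε : ℝ in 𝓝[>] 0, 1 - τ < bCHI (φ a) (φ (a + (ε : ℂ))) :=
      ((tendsto_bCHI_nhdsNE hΩo hφ ha).comp hp).eventually_const_lt (by linarith)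
    obtain ⟨ε, h0, h1, h2, h3⟩ := (e0.and (e1.and (e2.and e3))).exists
    exact ⟨ε, h0, h1, h2, h3⟩
  set aε : ℂ := a + (ε : ℂ) with haε_def
  have haεa : aε ≠ a := by
    intro h
    have h' := congrArg Complex.re h
    simp only [haε_def, Complex.add_re, Complex.ofReal_re] at h'
    linarith
  have hL3 : 0 < twoPointPlusCHI φ a aε := twoPointPlusCHI_pos' hΩo hφ ha haε haεa.symm
  have hβΩpos : 0 < bCHI (φ a) (φ aε) := by linarith
  /- Step 3: the comparison radius `R` (continuum limits in `𝔻` at `0`). -/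
  obtain ⟨R, hR1, hRε, hA1, hA2, hβ1, hβ2⟩ : ∃ R : ℝ, 1 < R ∧ ε < R ∧
      dist (twoPointPlusCHI c 0 ((ε : ℂ) / R) * ‖(ε : ℂ) / R - 0‖ ^ ((1 : ℝ) / 4)) 1 < τ ∧
      dist (twoPointPlusCHI c 0 ((Complex.mk (Real.sqrt 2 / 2) (Real.sqrt 2 / 2)) / R) * ‖(Complex.mk (Real.sqrt 2 / 2) (Real.sqrt 2 / 2)) / R - 0‖ ^ ((1 : ℝ) / 4)) 1 < τ ∧
      1 - τ < bCHI (c 0) (c ((ε : ℂ) / R)) ∧ 1 - τ < bCHI (c 0) (c ((Complex.mk (Real.sqrt 2 / 2) (Real.sqrt 2 / 2)) / R)) := by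
    have hp1 := tendsto_div_ofReal_atTop_nhdsNE (w := (ε : ℂ)) (by exact_mod_cast hε0.ne')
    have hp2 := tendsto_div_ofReal_atTop_nhdsNE pOne_ne_zero_CHI
    have hC := tendsto_twoPointPlusCHI_mul_rpow_norm hDo hc h0D
    have hBl := tendsto_bCHI_nhdsNE hDo hc h0D
    have e1 : ∀ᶠ R in atTop, (1 : ℝ) < R := eventually_gt_atTop 1
    have e2 : ∀ᶠ R in atTop, ε < R := eventually_gt_atTop ε
    have e3 : ∀ᶠ R : ℝ in atTop,
        dist (twoPointPlusCHI c 0 ((ε : ℂ) / R) * ‖(ε : ℂ) / R - 0‖ ^ ((1 : ℝ) / 4)) 1 < τ :=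
      Metric.tendsto_nhds.1 (hC.comp hp1) τ hτ0
    have e4 : ∀ᶠ R : ℝ in atTop,
        dist (twoPointPlusCHI c 0 ((Complex.mk (Real.sqrt 2 / 2) (Real.sqrt 2 / 2)) / R) * ‖(Complex.mk (Real.sqrt 2 / 2) (Real.sqrt 2 / 2)) / R - 0‖ ^ ((1 : ℝ) / 4)) 1 < τ :=
      Metric.tendsto_nhds.1 (hC.comp hp2) τ hτ0
    have e5 : ∀ᶠ R : ℝ in atTop, 1 - τ < bCHI (c 0) (c ((ε : ℂ) / R)) :=
      (hBl.comp hp1).eventually_const_lt (by linarith)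
    have e6 : ∀ᶠ R : ℝ in atTop, 1 - τ < bCHI (c 0) (c ((Complex.mk (Real.sqrt 2 / 2) (Real.sqrt 2 / 2)) / R)) :=
      (hBl.comp hp2).eventually_const_lt (by linarith)
    obtain ⟨R, h1, h2, h3, h4, h5, h6⟩ := (e1.and (e2.and (e3.and (e4.and (e5.and e6))))).exists
    exact ⟨R, h1, h2, h3, h4, h5, h6⟩
  have hR0 : 0 < R := by linarith
  set y₀ : ℂ := (ε : ℂ) / R with hy₀_def
  set pR : ℂ := (Complex.mk (Real.sqrt 2 / 2) (Real.sqrt 2 / 2)) / R with hpR_def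
  have hy₀D : y₀ ∈ ball (0 : ℂ) 1 := by
    rw [mem_ball, dist_zero_right, hy₀_def, norm_div, Complex.norm_real, Complex.norm_real,
      Real.norm_eq_abs, Real.norm_eq_abs, abs_of_pos hε0, abs_of_pos hR0, div_lt_one hR0]
    exact hRε
  have hpRD : pR ∈ ball (0 : ℂ) 1 := by
    rw [mem_ball, dist_zero_right, hpR_def, norm_div, norm_pOne_CHI, Complex.norm_real,
      Real.norm_eq_abs, abs_of_pos hR0, div_lt_one hR0]
    exact hR1
  have hy₀0 : y₀ ≠ 0 := div_ne_zero (by exact_mod_cast hε0.ne') (by exact_mod_cast hR0.ne')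
  have hpR0 : pR ≠ 0 := div_ne_zero pOne_ne_zero_CHI (by exact_mod_cast hR0.ne')
  have hL1 : 0 < twoPointPlusCHI c 0 y₀ := twoPointPlusCHI_pos' hDo hc h0D hy₀D hy₀0.symm
  have hL2 : 0 < twoPointPlusCHI c 0 pR := twoPointPlusCHI_pos' hDo hc h0D hpRD hpR0.symm
  have hβ1pos : 0 < bCHI (c 0) (c y₀) := by linarith
  have hβ2pos : 0 < bCHI (c 0) (c pR) := by linarith
  /- Step 4: the lattice displacement `v δ = [aε/δ] - [a/δ]` and the moving marked point of `𝔻`. -/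
  set v : ℝ → Site 2 := fun δ => nearestSite δ aε - nearestSite δ a with hv_def
  set yD : ℝ → ℂ := fun δ' => meshPoint δ' (v (R * δ')) with hyD_def
  have hT : Tendsto (fun δ : ℝ => δ / R) (𝓝[>] 0) (𝓝[>] 0) := by
    refine tendsto_nhdsWithin_iff.2 ⟨?_, ?_⟩
    · have h : Tendsto (fun δ : ℝ => δ / R) (𝓝 0) (𝓝 (0 / R)) := tendsto_id.div_const R
      rw [zero_div] at h
      exact h.mono_left nhdsWithin_le_nhds
    · filter_upwards [self_mem_nhdsWithin] with δ hδ
      exact div_pos hδ hR0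
  have hTm : Tendsto (fun δ : ℝ => R * δ) (𝓝[>] 0) (𝓝[>] 0) := by
    refine tendsto_nhdsWithin_iff.2 ⟨?_, ?_⟩
    · have h : Tendsto (fun δ : ℝ => R * δ) (𝓝 0) (𝓝 (R * 0)) := tendsto_id.const_mul R
      rw [mul_zero] at h
      exact h.mono_left nhdsWithin_le_nhds
    · filter_upwards [self_mem_nhdsWithin] with δ hδ
      exact mul_pos hR0 hδ
  have hvT : Tendsto (fun δ => meshPoint δ (v δ)) (𝓝[>] 0) (𝓝 (ε : ℂ)) := by
    have h := tendsto_meshPoint_nearestSite_sub a aε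
    rwa [haε_def, add_sub_cancel_left] at h
  have hRC : (R : ℂ) ≠ 0 := by exact_mod_cast hR0.ne'
  have hyD : Tendsto yD (𝓝[>] 0) (𝓝 y₀) := by
    have h := (hvT.comp hTm).const_mul ((R : ℂ)⁻¹)
    refine (h.congr' (Eventually.of_forall fun δ' => ?_)).trans ?_
    · simp only [Function.comp_def, hyD_def]
      have hmul : meshPoint (R * δ') (v (R * δ')) = (R : ℂ) * meshPoint δ' (v (R * δ')) := by
        apply Complex.ext <;> simp [mul_assoc]
      rw [hmul, ← mul_assoc, inv_mul_cancel₀ hRC, one_mul]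
    · rw [hy₀_def, div_eq_inv_mul]
  -- identities at `δ`: the marked points of `𝔻` at mesh `δ / R` round to `0`, `[p₁/δ]`, `v δ`
  have hid_p : ∀ δ, nearestSite (δ / R) pR = nearestSite δ (Complex.mk (Real.sqrt 2 / 2) (Real.sqrt 2 / 2)) := fun δ =>
    nearestSite_div δ hR0.ne' (Complex.mk (Real.sqrt 2 / 2) (Real.sqrt 2 / 2))
  have hid_y : ∀ δ, 0 < δ → nearestSite (δ / R) (yD (δ / R)) = v δ := by
    intro δ hδ
    simp only [hyD_def]
    rw [mul_div_cancel₀ δ hR0.ne', nearestSite_meshPoint (div_pos hδ hR0).ne']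
  /- Step 5: limits of the lattice ratios (the hypotheses). -/
  have gF1 : Tendsto (fun δ => meshIsingPlusCorr Ω δ ![a, b] / meshIsingPlusCorr Ω δ ![a, aε])
      (𝓝[>] 0) (𝓝 (M / twoPointPlusCHI φ a aε)) :=
    hR a ha (fun _ => b) b aε hb haε hab.symm haεa tendsto_const_nhds
  have gX : Tendsto (fun δ => meshIsingFreeCorr Ω δ ![a, aε] / meshIsingPlusCorr Ω δ ![a, aε])
      (𝓝[>] 0) (𝓝 (bCHI (φ a) (φ aε))) :=
    hB a ha (fun _ => aε) aε haε haεa tendsto_const_nhds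
  have gD : Tendsto (fun δ => meshIsingPlusCorr (ball (0 : ℂ) 1) (δ / R) ![0, yD (δ / R)] /
      meshIsingPlusCorr (ball (0 : ℂ) 1) (δ / R) ![0, pR]) (𝓝[>] 0)
      (𝓝 (twoPointPlusCHI c 0 y₀ / twoPointPlusCHI c 0 pR)) :=
    (hRD 0 h0D yD y₀ pR hy₀D hpRD hy₀0 hpR0 hyD).comp hT
  have gβ1 : Tendsto (fun δ => meshIsingFreeCorr (ball (0 : ℂ) 1) (δ / R) ![0, yD (δ / R)] /
      meshIsingPlusCorr (ball (0 : ℂ) 1) (δ / R) ![0, yD (δ / R)]) (𝓝[>] 0)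
      (𝓝 (bCHI (c 0) (c y₀))) :=
    (hBD 0 h0D yD y₀ hy₀D hy₀0 hyD).comp hT
  have gβ2 : Tendsto (fun δ => meshIsingFreeCorr (ball (0 : ℂ) 1) (δ / R) ![0, pR] /
      meshIsingPlusCorr (ball (0 : ℂ) 1) (δ / R) ![0, pR]) (𝓝[>] 0)
      (𝓝 (bCHI (c 0) (c pR))) :=
    (hBD 0 h0D (fun _ => pR) pR hpRD hpR0 tendsto_const_nhds).comp hT
  /- Step 6: eventual lattice facts. -/
  have sΩ : ∀ᶠ δ in 𝓝[>] (0 : ℝ), nearestSite δ a ∈ meshInteriorFinset Ω δ ∧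
      nearestSite δ aε ∈ meshInteriorFinset Ω δ ∧ nearestSite δ a ≠ nearestSite δ aε ∧
      nearestSite δ a ≠ nearestSite δ b := by
    filter_upwards [eventually_nearestSite_mem_meshInteriorFinset hM ha,
      eventually_nearestSite_mem_meshInteriorFinset hM haε, eventually_nearestSite_ne haεa.symm,
      eventually_nearestSite_ne hab] with δ h1 h2 h3 h4
    exact ⟨h1, h2, h3, h4⟩
  have sD : ∀ᶠ δ in 𝓝[>] (0 : ℝ),
      nearestSite (δ / R) 0 ∈ meshInteriorFinset (ball (0 : ℂ) 1) (δ / R) ∧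
      nearestSite (δ / R) pR ∈ meshInteriorFinset (ball (0 : ℂ) 1) (δ / R) ∧
      nearestSite (δ / R) (yD (δ / R)) ∈ meshInteriorFinset (ball (0 : ℂ) 1) (δ / R) ∧
      nearestSite (δ / R) 0 ≠ nearestSite (δ / R) (yD (δ / R)) ∧
      nearestSite (δ / R) 0 ≠ nearestSite (δ / R) pR := by
    have h := (eventually_nearestSite_mem_meshInteriorFinset meshApproximates_ball h0D).and
      ((eventually_nearestSite_mem_meshInteriorFinset meshApproximates_ball hpRD).and
      ((eventually_nearestSite_mem_of_tendsto hDo meshApproximates_ball hy₀D hyD).and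
      ((eventually_nearestSite_ne_of_tendsto hy₀0 hyD).and
      (eventually_nearestSite_ne (Ne.symm hpR0)))))
    filter_upwards [hT.eventually h] with δ hδ
    exact ⟨hδ.1, hδ.2.1, hδ.2.2.1, hδ.2.2.2.1, hδ.2.2.2.2⟩
  -- positivity of the free correlations, from the limits
  have posF : ∀ᶠ δ in 𝓝[>] (0 : ℝ),
      0 < meshIsingFreeCorr Ω δ ![a, aε] / meshIsingPlusCorr Ω δ ![a, aε] :=
    gX.eventually_const_lt hβΩpos
  have posFD : ∀ᶠ δ in 𝓝[>] (0 : ℝ), 0 < meshIsingFreeCorr (ball (0 : ℂ) 1) (δ / R) ![0, pR] /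
      meshIsingPlusCorr (ball (0 : ℂ) 1) (δ / R) ![0, pR] :=
    gβ2.eventually_const_lt hβ2pos
  /- Step 7: the sandwich, eventually. Notation: `T = ⟨σ_0σ_{v δ}⟩_{ℤ²}`, `ρ = ϱ(δ)`. -/
  have main : ∀ᶠ δ in 𝓝[>] (0 : ℝ),
      meshIsingPlusCorr Ω δ ![a, b] / meshIsingPlusCorr Ω δ ![a, aε] *
          (meshIsingFreeCorr (ball (0 : ℂ) 1) (δ / R) ![0, yD (δ / R)] /
              meshIsingPlusCorr (ball (0 : ℂ) 1) (δ / R) ![0, yD (δ / R)] *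
            (meshIsingPlusCorr (ball (0 : ℂ) 1) (δ / R) ![0, yD (δ / R)] /
              meshIsingPlusCorr (ball (0 : ℂ) 1) (δ / R) ![0, pR])) ≤
        meshIsingPlusCorr Ω δ ![a, b] / rhoCHI δ ∧
      meshIsingPlusCorr Ω δ ![a, b] / rhoCHI δ ≤
        meshIsingPlusCorr Ω δ ![a, b] / meshIsingPlusCorr Ω δ ![a, aε] *
          (meshIsingFreeCorr Ω δ ![a, aε] / meshIsingPlusCorr Ω δ ![a, aε])⁻¹ *
          (meshIsingPlusCorr (ball (0 : ℂ) 1) (δ / R) ![0, yD (δ / R)] /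
              meshIsingPlusCorr (ball (0 : ℂ) 1) (δ / R) ![0, pR] *
            (meshIsingFreeCorr (ball (0 : ℂ) 1) (δ / R) ![0, pR] /
              meshIsingPlusCorr (ball (0 : ℂ) 1) (δ / R) ![0, pR])⁻¹) := by
    filter_upwards [sΩ, sD, posF, posFD, self_mem_nhdsWithin] with δ hsΩ hsD hposF hposFD hδ0
    have hδ0' : (0 : ℝ) < δ := hδ0
    obtain ⟨maΩ, mεΩ, neaε, neab⟩ := hsΩ
    obtain ⟨m0D, mpD, myD, ne0y, ne0p⟩ := hsD
    -- abbreviations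
    set Pab := meshIsingPlusCorr Ω δ ![a, b]
    set Paε := meshIsingPlusCorr Ω δ ![a, aε]
    set Faε := meshIsingFreeCorr Ω δ ![a, aε]
    set PDy := meshIsingPlusCorr (ball (0 : ℂ) 1) (δ / R) ![0, yD (δ / R)]
    set FDy := meshIsingFreeCorr (ball (0 : ℂ) 1) (δ / R) ![0, yD (δ / R)]
    set PDp := meshIsingPlusCorr (ball (0 : ℂ) 1) (δ / R) ![0, pR]
    set FDp := meshIsingFreeCorr (ball (0 : ℂ) 1) (δ / R) ![0, pR]
    set T := twoPointPlus 2 criticalBetaTwo (v δ)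
    set ρ := rhoCHI δ
    -- the six comparisons with the plus state of `ℤ²`
    have i1 : T ≤ Paε := twoPointPlus_le_meshIsingPlusCorr_two Ω δ neaε
    have i2 : Faε ≤ T := meshIsingFreeCorr_two_le_twoPointPlus maΩ mεΩ neaε
    have i3 : T ≤ PDy := by
      have h := twoPointPlus_le_meshIsingPlusCorr_two (ball (0 : ℂ) 1) (δ / R) ne0y
      rwa [hid_y δ hδ0', nearestSite_zero, sub_zero] at h
    have i4 : FDy ≤ T := by
      have h := meshIsingFreeCorr_two_le_twoPointPlus m0D myD ne0y
      rwa [hid_y δ hδ0', nearestSite_zero, sub_zero] at h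
    have i5 : ρ ≤ PDp := by
      have h := twoPointPlus_le_meshIsingPlusCorr_two (ball (0 : ℂ) 1) (δ / R) ne0p
      rwa [hid_p δ, nearestSite_zero, sub_zero, ← rhoCHI_eq] at h
    have i6 : FDp ≤ ρ := by
      have h := meshIsingFreeCorr_two_le_twoPointPlus m0D mpD ne0p
      rwa [hid_p δ, nearestSite_zero, sub_zero, ← rhoCHI_eq] at h
    have posab : 0 < Pab :=
      lt_of_lt_of_le (twoPointPlus_pos criticalBetaTwo_pos _)
        (twoPointPlus_le_meshIsingPlusCorr_two Ω δ neab)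
    have hT0 : 0 < T := twoPointPlus_pos criticalBetaTwo_pos _
    have hρ0 : 0 < ρ := rhoCHI_pos δ
    have hPaε : 0 < Paε := lt_of_lt_of_le hT0 i1
    have hPDy : 0 < PDy := lt_of_lt_of_le hT0 i3
    have hPDp : 0 < PDp := lt_of_lt_of_le hρ0 i5
    have hFaε : 0 < Faε := (div_pos_iff_of_pos_right hPaε).1 hposF
    have hFDp : 0 < FDp := (div_pos_iff_of_pos_right hPDp).1 hposFD
    constructor
    · -- lower bound: `𝔼^free_𝔻 ≤ T ≤ 𝔼⁺_Ω[σ_aσ_{aε}]` and `ϱ ≤ 𝔼⁺_𝔻[σ_0σ_{p_R}]`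
      have e1 : FDy / PDy * (PDy / PDp) = FDy / PDp := by field_simp
      have e2 : FDy / PDp ≤ Paε / ρ := div_le_div₀ hPaε.le (i4.trans i1) hρ0 i5
      have e3 : Pab / Paε * (Paε / ρ) = Pab / ρ := by field_simp
      rw [e1]
      calc Pab / Paε * (FDy / PDp) ≤ Pab / Paε * (Paε / ρ) :=
            mul_le_mul_of_nonneg_left e2 (div_nonneg posab.le hPaε.le)
        _ = Pab / ρ := e3
    · -- upper bound: `𝔼^free_Ω[σ_aσ_{aε}] ≤ T ≤ 𝔼⁺_𝔻` and `𝔼^free_𝔻[σ_0σ_{p_R}] ≤ ϱ`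
      have e1 : Pab / Paε * (Faε / Paε)⁻¹ * (PDy / PDp * (FDp / PDp)⁻¹) =
          Pab / Faε * (PDy / FDp) := by
        field_simp
      have e3 : Pab / ρ = Pab / Faε * (Faε / ρ) := by field_simp
      have e4 : Faε / ρ ≤ PDy / FDp := div_le_div₀ hPDy.le (i2.trans i3) hFDp i6
      rw [e1, e3]
      exact mul_le_mul_of_nonneg_left e4 (div_nonneg posab.le hFaε.le)
  /- Step 8: the limits of the two bounds, and their values. -/
  set L1 := twoPointPlusCHI c 0 y₀ with hL1_def
  set L2 := twoPointPlusCHI c 0 pR with hL2_def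
  set L3 := twoPointPlusCHI φ a aε with hL3_def
  set β₁ := bCHI (c 0) (c y₀) with hβ₁_def
  set β₂ := bCHI (c 0) (c pR) with hβ₂_def
  set βΩ := bCHI (φ a) (φ aε) with hβΩ_def
  have glo : Tendsto (fun δ => meshIsingPlusCorr Ω δ ![a, b] / meshIsingPlusCorr Ω δ ![a, aε] *
      (meshIsingFreeCorr (ball (0 : ℂ) 1) (δ / R) ![0, yD (δ / R)] /
          meshIsingPlusCorr (ball (0 : ℂ) 1) (δ / R) ![0, yD (δ / R)] *
        (meshIsingPlusCorr (ball (0 : ℂ) 1) (δ / R) ![0, yD (δ / R)] /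
          meshIsingPlusCorr (ball (0 : ℂ) 1) (δ / R) ![0, pR]))) (𝓝[>] 0)
      (𝓝 (M / L3 * (β₁ * (L1 / L2)))) :=
    gF1.mul (gβ1.mul gD)
  have ghi : Tendsto (fun δ => meshIsingPlusCorr Ω δ ![a, b] / meshIsingPlusCorr Ω δ ![a, aε] *
      (meshIsingFreeCorr Ω δ ![a, aε] / meshIsingPlusCorr Ω δ ![a, aε])⁻¹ *
      (meshIsingPlusCorr (ball (0 : ℂ) 1) (δ / R) ![0, yD (δ / R)] /
          meshIsingPlusCorr (ball (0 : ℂ) 1) (δ / R) ![0, pR] *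
        (meshIsingFreeCorr (ball (0 : ℂ) 1) (δ / R) ![0, pR] /
          meshIsingPlusCorr (ball (0 : ℂ) 1) (δ / R) ![0, pR])⁻¹)) (𝓝[>] 0)
      (𝓝 (M / L3 * βΩ⁻¹ * (L1 / L2 * β₂⁻¹))) :=
    (gF1.mul (gX.inv₀ hβΩpos.ne')).mul (gD.mul (gβ2.inv₀ hβ2pos.ne'))
  -- the three continuum quantities pinned by (2.23): `Aᵢ ∈ (1 - τ, 1 + τ)`
  have hA1' : 1 - τ < L1 * ‖y₀ - 0‖ ^ ((1 : ℝ) / 4) ∧ L1 * ‖y₀ - 0‖ ^ ((1 : ℝ) / 4) < 1 + τ := by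
    rw [Real.dist_eq, abs_sub_lt_iff] at hA1
    constructor <;> linarith [hA1.1, hA1.2]
  have hA2' : 1 - τ < L2 * ‖pR - 0‖ ^ ((1 : ℝ) / 4) ∧ L2 * ‖pR - 0‖ ^ ((1 : ℝ) / 4) < 1 + τ := by
    rw [Real.dist_eq, abs_sub_lt_iff] at hA2
    constructor <;> linarith [hA2.1, hA2.2]
  have hA3' : 1 - τ < L3 * ‖aε - a‖ ^ ((1 : ℝ) / 4) ∧ L3 * ‖aε - a‖ ^ ((1 : ℝ) / 4) < 1 + τ := by
    rw [Real.dist_eq, abs_sub_lt_iff] at hA3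
    constructor <;> linarith [hA3.1, hA3.2]
  set A1 := L1 * ‖y₀ - 0‖ ^ ((1 : ℝ) / 4) with hA1_def
  set A2 := L2 * ‖pR - 0‖ ^ ((1 : ℝ) / 4) with hA2_def
  set A3 := L3 * ‖aε - a‖ ^ ((1 : ℝ) / 4) with hA3_def
  have hA1pos : 0 < A1 := by linarith [hA1'.1]
  have hA2pos : 0 < A2 := by linarith [hA2'.1]
  have hA3pos : 0 < A3 := by linarith [hA3'.1]
  have hn1 : ‖y₀ - 0‖ ^ ((1 : ℝ) / 4) = ε ^ ((1 : ℝ) / 4) * R⁻¹ ^ ((1 : ℝ) / 4) := by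
    rw [sub_zero, hy₀_def, norm_div, Complex.norm_real, Complex.norm_real, Real.norm_eq_abs,
      Real.norm_eq_abs, abs_of_pos hε0, abs_of_pos hR0, div_eq_mul_inv,
      Real.mul_rpow hε0.le (inv_nonneg.2 hR0.le)]
  have hn2 : ‖pR - 0‖ ^ ((1 : ℝ) / 4) = R⁻¹ ^ ((1 : ℝ) / 4) := by
    rw [sub_zero, hpR_def, norm_div, norm_pOne_CHI, Complex.norm_real, Real.norm_eq_abs,
      abs_of_pos hR0, one_div]
  have hn3 : ‖aε - a‖ ^ ((1 : ℝ) / 4) = ε ^ ((1 : ℝ) / 4) := by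
    rw [haε_def, add_sub_cancel_left, Complex.norm_real, Real.norm_eq_abs, abs_of_pos hε0]
  have hr4 : R⁻¹ ^ ((1 : ℝ) / 4) ≠ 0 := (Real.rpow_pos_of_pos (inv_pos.2 hR0) _).ne'
  have hε4 : ε ^ ((1 : ℝ) / 4) ≠ 0 := (Real.rpow_pos_of_pos hε0 _).ne'
  have hL1ne : L1 ≠ 0 := hL1.ne'
  have hL2ne : L2 ≠ 0 := hL2.ne'
  have hL3ne : L3 ≠ 0 := hL3.ne'
  have hkey : M / L3 * (L1 / L2) = M * A1 / (A2 * A3) := by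
    rw [hA1_def, hA2_def, hA3_def, hn1, hn2, hn3]
    field_simp
  have hlo_val : M - e / 2 < M / L3 * (β₁ * (L1 / L2)) := by
    have h1 : M / L3 * (β₁ * (L1 / L2)) = M * (A1 * β₁ / (A2 * A3)) := by
      calc M / L3 * (β₁ * (L1 / L2)) = M / L3 * (L1 / L2) * β₁ := by ring
        _ = M * A1 / (A2 * A3) * β₁ := by rw [hkey]
        _ = M * (A1 * β₁ / (A2 * A3)) := by ring
    have hA23 : A2 * A3 < (1 + τ) ^ 2 :=
      calc A2 * A3 < (1 + τ) * A3 := mul_lt_mul_of_pos_right hA2'.2 hA3pos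
        _ ≤ (1 + τ) * (1 + τ) := mul_le_mul_of_nonneg_left hA3'.2.le (by linarith)
        _ = (1 + τ) ^ 2 := by ring
    have hAβ : (1 - τ) ^ 2 ≤ A1 * β₁ := by
      rw [sq]
      exact mul_le_mul hA1'.1.le hβ1.le h1τ.le hA1pos.le
    have h2 : (1 - τ) ^ 2 / (1 + τ) ^ 2 < A1 * β₁ / (A2 * A3) := by
      rw [div_lt_div_iff₀ (by positivity) (by positivity)]
      calc (1 - τ) ^ 2 * (A2 * A3) < (1 - τ) ^ 2 * (1 + τ) ^ 2 :=
            mul_lt_mul_of_pos_left hA23 (by positivity)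
        _ ≤ A1 * β₁ * (1 + τ) ^ 2 := mul_le_mul_of_nonneg_right hAβ (by positivity)
    rw [h1]
    exact hτlo.trans (mul_lt_mul_of_pos_left h2 hM0)
  have hhi_val : M / L3 * βΩ⁻¹ * (L1 / L2 * β₂⁻¹) < M + e / 2 := by
    have h1 : M / L3 * βΩ⁻¹ * (L1 / L2 * β₂⁻¹) = M * (A1 / (A2 * A3 * βΩ * β₂)) := by
      calc M / L3 * βΩ⁻¹ * (L1 / L2 * β₂⁻¹) = M / L3 * (L1 / L2) * (βΩ⁻¹ * β₂⁻¹) := by ring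
        _ = M * A1 / (A2 * A3) * (βΩ⁻¹ * β₂⁻¹) := by rw [hkey]
        _ = M * (A1 / (A2 * A3 * βΩ * β₂)) := by ring
    have h12 : (1 - τ) * (1 - τ) ≤ A2 * A3 := mul_le_mul hA2'.1.le hA3'.1.le h1τ.le hA2pos.le
    have h34 : (1 - τ) * (1 - τ) ≤ βΩ * β₂ := mul_le_mul hβΩ.le hβ2.le h1τ.le hβΩpos.le
    have hprod : (1 - τ) ^ 4 ≤ A2 * A3 * βΩ * β₂ :=
      calc (1 - τ) ^ 4 = (1 - τ) * (1 - τ) * ((1 - τ) * (1 - τ)) := by ring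
        _ ≤ A2 * A3 * (βΩ * β₂) := mul_le_mul h12 h34 (by positivity) (by positivity)
        _ = A2 * A3 * βΩ * β₂ := by ring
    have hPpos : 0 < A2 * A3 * βΩ * β₂ := by positivity
    have h2 : A1 / (A2 * A3 * βΩ * β₂) < (1 + τ) / (1 - τ) ^ 4 := by
      rw [div_lt_div_iff₀ hPpos (by positivity)]
      calc A1 * (1 - τ) ^ 4 ≤ A1 * (A2 * A3 * βΩ * β₂) := mul_le_mul_of_nonneg_left hprod hA1pos.le
        _ < (1 + τ) * (A2 * A3 * βΩ * β₂) := mul_lt_mul_of_pos_right hA1'.2 hPpos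
    rw [h1]
    exact (mul_lt_mul_of_pos_left h2 hM0).trans hτhi
  /- Step 9: conclusion. -/
  have ev_lo := glo.eventually_const_lt (show M - e < M / L3 * (β₁ * (L1 / L2)) by linarith)
  have ev_hi := ghi.eventually_lt_const (show M / L3 * βΩ⁻¹ * (L1 / L2 * β₂⁻¹) < M + e by linarith)
  filter_upwards [main, ev_lo, ev_hi] with δ hmain hlo hhi
  rw [Real.dist_eq, abs_sub_lt_iff]
  constructor <;> linarith [hmain.1, hmain.2]

/-- **CHI Theorem 1.1, free boundary conditions, for one domain and one pair of points** (last
paragraph of §2.9: "`𝔼^free ∼ 𝓑_Ω(a;b) · 𝔼⁺ ∼ ϱ(δ) 𝓑_Ω(a;b) ⟨σ_aσ_b⟩⁺_Ω = ϱ(δ) ⟨σ_aσ_b⟩^free_Ω`"):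
under the hypotheses of `tendsto_twoPoint_rho_of_ratios`,
`𝔼^free_{Ω_δ}[σ_aσ_b] / ϱ(δ) → ⟨σ_aσ_b⟩^free_Ω` (`twoPointFreeCHI`).
[cite: ChelkakHonglerIzyurovAnnals2015, §2.9, proof of Thm. 1.1 (free boundary conditions); Thm. 1.7] -/
theorem tendsto_twoPoint_free_rho_of_ratios {Ω : Set ℂ} (hΩ : IsAdmissibleDomain Ω)
    (hM : MeshApproximates Ω) {φ : ℂ → ℂ}
    (hφ : IsConformalBijection φ Ω UpperHalfPlane.upperHalfPlaneSet) {c : ℂ → ℂ}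
    (hc : IsConformalBijection c (ball (0 : ℂ) 1) UpperHalfPlane.upperHalfPlaneSet)
    (hR : ∀ x ∈ Ω, ∀ (y : ℝ → ℂ) (y₀ y' : ℂ), y₀ ∈ Ω → y' ∈ Ω → y₀ ≠ x → y' ≠ x →
      Tendsto y (𝓝[>] 0) (𝓝 y₀) →
        Tendsto (fun δ => meshIsingPlusCorr Ω δ ![x, y δ] / meshIsingPlusCorr Ω δ ![x, y'])
          (𝓝[>] 0) (𝓝 (twoPointPlusCHI φ x y₀ / twoPointPlusCHI φ x y')))
    (hB : ∀ x ∈ Ω, ∀ (y : ℝ → ℂ) (y₀ : ℂ), y₀ ∈ Ω → y₀ ≠ x → Tendsto y (𝓝[>] 0) (𝓝 y₀) →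
        Tendsto (fun δ => meshIsingFreeCorr Ω δ ![x, y δ] / meshIsingPlusCorr Ω δ ![x, y δ])
          (𝓝[>] 0) (𝓝 (bCHI (φ x) (φ y₀))))
    (hRD : ∀ x ∈ ball (0 : ℂ) 1, ∀ (y : ℝ → ℂ) (y₀ y' : ℂ), y₀ ∈ ball (0 : ℂ) 1 →
      y' ∈ ball (0 : ℂ) 1 → y₀ ≠ x → y' ≠ x → Tendsto y (𝓝[>] 0) (𝓝 y₀) →
        Tendsto (fun δ => meshIsingPlusCorr (ball (0 : ℂ) 1) δ ![x, y δ] /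
            meshIsingPlusCorr (ball (0 : ℂ) 1) δ ![x, y'])
          (𝓝[>] 0) (𝓝 (twoPointPlusCHI c x y₀ / twoPointPlusCHI c x y')))
    (hBD : ∀ x ∈ ball (0 : ℂ) 1, ∀ (y : ℝ → ℂ) (y₀ : ℂ), y₀ ∈ ball (0 : ℂ) 1 → y₀ ≠ x →
      Tendsto y (𝓝[>] 0) (𝓝 y₀) →
        Tendsto (fun δ => meshIsingFreeCorr (ball (0 : ℂ) 1) δ ![x, y δ] /
            meshIsingPlusCorr (ball (0 : ℂ) 1) δ ![x, y δ])
          (𝓝[>] 0) (𝓝 (bCHI (c x) (c y₀))))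
    {a b : ℂ} (ha : a ∈ Ω) (hb : b ∈ Ω) (hab : a ≠ b) :
    Tendsto (fun δ => meshIsingFreeCorr Ω δ ![a, b] / rhoCHI δ) (𝓝[>] 0)
      (𝓝 (twoPointFreeCHI φ a b)) := by
  have hP := tendsto_twoPoint_rho_of_ratios hΩ hM hφ hc hR hB hRD hBD ha hb hab
  have hF := hB a ha (fun _ => b) b hb hab.symm tendsto_const_nhds
  have hφa : 0 < (φ a).im := hφ.2.mapsTo ha
  have hφb : 0 < (φ b).im := hφ.2.mapsTo hb
  have hw1 : φ b ≠ φ a := fun h => hab (hφ.2.injOn ha hb h.symm)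
  have hw2 : φ b ≠ (starRingEnd ℂ) (φ a) := fun h => by
    have h' := congrArg Complex.im h
    rw [Complex.conj_im] at h'
    linarith
  rw [twoPointFreeCHI_eq_mul_bCHI hw1 hw2, mul_comm]
  refine (hF.mul hP).congr' ?_
  filter_upwards [eventually_nearestSite_ne hab] with δ hne
  have hpos : 0 < meshIsingPlusCorr Ω δ ![a, b] :=
    lt_of_lt_of_le (twoPointPlus_pos criticalBetaTwo_pos _)
      (twoPointPlus_le_meshIsingPlusCorr_two Ω δ hne)
  field_simp

/-- **CHI Theorem 1.1 (both boundary conditions, `ϱ`-normalised, pointwise) for every admissible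
approximable domain, from CHI Prop. 2.20 (`k = 1`, with Remark 2.21) and CHI Thm. 1.7** stated for
all such domains and all conformal bijections onto `ℍ` (moving-point form, see the module
docstring): for distinct `x, y ∈ Ω`,
`𝔼⁺_{Ω_δ}[σ_xσ_y] / ϱ(δ) → ⟨σ_xσ_y⟩⁺_Ω` and `𝔼^free_{Ω_δ}[σ_xσ_y] / ϱ(δ) → ⟨σ_xσ_y⟩^free_Ω`
(the explicit limits (1.2)–(1.3), `twoPointPlusCHI`, `twoPointFreeCHI`). The unit disc with the
inverse Cayley map (`meshApproximates_ball`, `SlitDisc.isConformalBijection_cayleyInvFun`) serves as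
the comparison domain `Λ` of CHI's proof.
[cite: ChelkakHonglerIzyurovAnnals2015, Thm. 1.1 and §2.9; Prop. 2.20; Thm. 1.7] -/
theorem chi_twoPoint_rho_of_ratios
    (hR : ∀ (Ω : Set ℂ), IsAdmissibleDomain Ω → MeshApproximates Ω → ∀ (φ : ℂ → ℂ),
      IsConformalBijection φ Ω UpperHalfPlane.upperHalfPlaneSet →
        ∀ x ∈ Ω, ∀ (y : ℝ → ℂ) (y₀ y' : ℂ), y₀ ∈ Ω → y' ∈ Ω → y₀ ≠ x → y' ≠ x →
          Tendsto y (𝓝[>] 0) (𝓝 y₀) →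
            Tendsto (fun δ => meshIsingPlusCorr Ω δ ![x, y δ] / meshIsingPlusCorr Ω δ ![x, y'])
              (𝓝[>] 0) (𝓝 (twoPointPlusCHI φ x y₀ / twoPointPlusCHI φ x y')))
    (hB : ∀ (Ω : Set ℂ), IsAdmissibleDomain Ω → MeshApproximates Ω → ∀ (φ : ℂ → ℂ),
      IsConformalBijection φ Ω UpperHalfPlane.upperHalfPlaneSet →
        ∀ x ∈ Ω, ∀ (y : ℝ → ℂ) (y₀ : ℂ), y₀ ∈ Ω → y₀ ≠ x → Tendsto y (𝓝[>] 0) (𝓝 y₀) →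
          Tendsto (fun δ => meshIsingFreeCorr Ω δ ![x, y δ] / meshIsingPlusCorr Ω δ ![x, y δ])
            (𝓝[>] 0) (𝓝 (bCHI (φ x) (φ y₀)))) :
    (∀ (Ω : Set ℂ), IsAdmissibleDomain Ω → MeshApproximates Ω → ∀ (φ : ℂ → ℂ),
      IsConformalBijection φ Ω UpperHalfPlane.upperHalfPlaneSet → ∀ x ∈ Ω, ∀ y ∈ Ω, x ≠ y →
        Tendsto (fun δ => meshIsingPlusCorr Ω δ ![x, y] / rhoCHI δ) (𝓝[>] 0)
          (𝓝 (twoPointPlusCHI φ x y))) ∧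
    (∀ (Ω : Set ℂ), IsAdmissibleDomain Ω → MeshApproximates Ω → ∀ (φ : ℂ → ℂ),
      IsConformalBijection φ Ω UpperHalfPlane.upperHalfPlaneSet → ∀ x ∈ Ω, ∀ y ∈ Ω, x ≠ y →
        Tendsto (fun δ => meshIsingFreeCorr Ω δ ![x, y] / rhoCHI δ) (𝓝[>] 0)
          (𝓝 (twoPointFreeCHI φ x y))) := by
  have hD := SlitDisc.isAdmissibleDomain_ball
  have hc := SlitDisc.isConformalBijection_cayleyInvFun
  have hRD := hR _ hD meshApproximates_ball _ hc
  have hBD := hB _ hD meshApproximates_ball _ hc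
  exact ⟨fun Ω hΩ hM φ hφ x hx y hy hxy =>
      tendsto_twoPoint_rho_of_ratios hΩ hM hφ hc (hR Ω hΩ hM φ hφ) (hB Ω hΩ hM φ hφ) hRD hBD hx hy hxy,
    fun Ω hΩ hM φ hφ x hx y hy hxy =>
      tendsto_twoPoint_free_rho_of_ratios hΩ hM hφ hc (hR Ω hΩ hM φ hφ) (hB Ω hΩ hM φ hφ) hRD hBD
        hx hy hxy⟩

/-- **CHI Theorem 1.3 (`k = 0`), i.e. the named fact `chi_onePoint_rho`, from CHI Prop. 2.20
(`k = 1`, with Remark 2.21) and CHI Thm. 1.7** (moving-point forms, for all admissible approximable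
domains): the chain `Prop 2.20 & Thm 1.7 ⇒ Thm 1.1 (+ and free)` (§2.9, this file) `⇒ Thm 1.3, k = 0`
(§2.10, `chi_onePoint_rho_of_twoPoint`). What remains hypothetical is exactly the output of the
discrete spinor observable analysis of CHI (Thms 1.5 and 1.7, §§2.2–2.8 and §3).
[cite: ChelkakHonglerIzyurovAnnals2015, §§2.9–2.10 (proofs of Thms. 1.1 and 1.3); Prop. 2.20; Thm. 1.7] -/
theorem chi_onePoint_rho_of_ratios
    (hR : ∀ (Ω : Set ℂ), IsAdmissibleDomain Ω → MeshApproximates Ω → ∀ (φ : ℂ → ℂ),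
      IsConformalBijection φ Ω UpperHalfPlane.upperHalfPlaneSet →
        ∀ x ∈ Ω, ∀ (y : ℝ → ℂ) (y₀ y' : ℂ), y₀ ∈ Ω → y' ∈ Ω → y₀ ≠ x → y' ≠ x →
          Tendsto y (𝓝[>] 0) (𝓝 y₀) →
            Tendsto (fun δ => meshIsingPlusCorr Ω δ ![x, y δ] / meshIsingPlusCorr Ω δ ![x, y'])
              (𝓝[>] 0) (𝓝 (twoPointPlusCHI φ x y₀ / twoPointPlusCHI φ x y')))
    (hB : ∀ (Ω : Set ℂ), IsAdmissibleDomain Ω → MeshApproximates Ω → ∀ (φ : ℂ → ℂ),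
      IsConformalBijection φ Ω UpperHalfPlane.upperHalfPlaneSet →
        ∀ x ∈ Ω, ∀ (y : ℝ → ℂ) (y₀ : ℂ), y₀ ∈ Ω → y₀ ≠ x → Tendsto y (𝓝[>] 0) (𝓝 y₀) →
          Tendsto (fun δ => meshIsingFreeCorr Ω δ ![x, y δ] / meshIsingPlusCorr Ω δ ![x, y δ])
            (𝓝[>] 0) (𝓝 (bCHI (φ x) (φ y₀)))) :
    chi_onePoint_rho := by
  obtain ⟨hT, hTf⟩ := chi_twoPoint_rho_of_ratios hR hB
  exact chi_onePoint_rho_of_twoPoint hT hTf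

end Main

end Literature.Probability.LatticeModels
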